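import Literature.AlgebraicGeometry.AbelianSchemes.AbelianSchemeQuotientDualPair
import Literature.AlgebraicGeometry.AbelianSchemes.AbelianSchemeQuotientPoincareDescendedPicZero
import Literature.AlgebraicGeometry.AbelianSchemes.RigidifyAlongUnitSlice
import HarnessLib

/-!
# The dual pair of `A/K` with the RIGIDIFIED descended Poincaré sheaf: clauses `hasRank_one`, `rigid`,
# `fibrewisePicZero` discharged (HECKE-LINK H2, file (ii) D5 by name)

Layer `Literature/AlgebraicGeometry/AbelianSchemes`, namespace `Literature.AlgebraicGeometry.AbelianSchemes.AbelianSchemeOver`.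
Definitions with bodies (`poincareQuotProd`, `poincareQuotRigid` — the descended Poincaré sheaf read in the `prodLeft`
spelling of ★ `DualPair.P`, resp. its rigidification — and the assembly `dualPairOfQuotientRigidified`, a `DualPair`
structure literal) and theorems; no `def … : Prop`, no named fact, no instance, no notation, no `sorry`.

Setting of ★ `AbelianSchemeQuotientDualPair` (D4, [MumfordAV1970] §15 Thm. 1 «the dual of `A/C` is `Â/C^⊥`» by two-step
descent): `B := A/K`, `𝒩₁ = (π × 1)^*𝒫` on `B ×_S Â` (★ `poincarePullback`, the module of the rigidified family ★
`poincarePullbackBundle`), a `K′`-equivariant structure `Φ` on `𝒩₁` (D3b), the descended Poincaré sheaf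
`𝒫_B := poincareQuot Φ` on `B ×_S (Â/K′)` with `(B ◁ ψ̂)^* 𝒫_B ≅ 𝒩₁` (★ `poincareQuotIso`) and `HasRank 𝒫_B 1`
(★ `hasRank_poincareQuot`).  Here `𝒫_B` is NORMALISED along `e_B × 1` à la [MumfordFogartyKirwan1994] Ch. 6 §2 (p. 121) by
★ `rigidify` (`𝒫_B ⊗ (pr^* (e_B × 1)^* 𝒫_B)^∨`), which keeps the rank, the defining isomorphism with `𝒩₁` (★
`nonempty_pullback_whiskerLeft_rigidify_iso`, as `𝒩₁` is rigidified) and clause (a) (★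
`forall_isHomogeneous_fibreSlice_of_descended`), and makes clause (b) `rigid` hold (★
`nonempty_pullback_unitSlice_rigidify_iso`).

* §1 `poincareQuotProd` (= `𝒫_B` on `(A/K).prodLeft (Â/K′)`; the carrier `((A/K).X ⊗ (Â/K′).X).left` of ★ `poincareQuot`
  is this scheme by `rfl`, and pinning the spelling once keeps the elaboration of every clause below cheap),
  `hasRank_poincareQuotProd`, `nonempty_pullback_whiskerLeft_poincareQuotProd_iso` (★ `poincareQuotIso` re-read);
* §2 `poincareQuotRigid := rigidify 𝒫_B` with `hasRank_poincareQuotRigid`,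
  **`nonempty_pullback_whiskerLeft_poincareQuotRigid_iso`** (`(B ◁ ψ̂)^* 𝒫_B^{rig} ≅ 𝒩₁`), **`rigid_poincareQuotRigid`**
  (clause (b)), **`fibrewisePicZero_poincareQuotRigid`** (clause (a));
* §3 **`dualPairOfQuotientRigidified … Φ (h4)`** — the assembly with `hat := Â/K′`, `P := 𝒫_B^{rig}` and the clauses
  `hasRank_one`, `rigid`, `fibrewisePicZero` PROVED; the ONE remaining raw hypothesis is the universal property `h4` for
  `𝒫_B^{rig}` (D6; its isomorphisms may be produced up to a `pr_T^*`-twist and then straightened by ★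
  `nonempty_pullback_iso_of_iso_tensorObj`); `dualPairOfQuotientRigidified_hat/_P` (`rfl`).

HC_CM is proved only modulo the 7 printed citations until rung 0 closes; nothing here is about HC.

## References
* [MumfordAV1970] D. Mumford, *Abelian Varieties* (1970), §8 ((iv) ⇔ (i)), §12 Thm. 1 (p. 112), §15 Thm. 1 (p. 143).
* [MumfordFogartyKirwan1994] D. Mumford, J. Fogarty, F. Kirwan, *GIT*, 3rd ed. (1994), Ch. 6 §2 (p. 121).
* [MilneAV2008] J. S. Milne, *Abelian Varieties* (2008), I §8 (pp. 36–37), I §9 Thm. 9.1 (p. 42).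
-/

noncomputable section

universe u

open CategoryTheory CategoryTheory.Limits AlgebraicGeometry MonoidalCategory CartesianMonoidalCategory
open scoped MonObj

namespace Literature.AlgebraicGeometry.AbelianSchemes

namespace AbelianSchemeOver

open Literature.AlgebraicGeometry.RelativeSpec Literature.AlgebraicGeometry.AbelianVarieties
  Literature.AlgebraicGeometry.Motives Literature.AlgebraicGeometry.Modules

variable {S : Scheme.{u}} (A : AbelianSchemeOver S)
  {Y : Scheme.{u}} (u : S ⟶ Y) (K : Subgroup A.Sections) [IsCommMonObj A.X] {n : ℕ}
  (hK : ∀ σ : K, (σ : A.Sections) ^ n = 1)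
  [Finite K] [Y.IsSeparated] [IsSeparated (A.X.hom ≫ u)] [S.IsSeparated]
  (hcov : ∀ x : A.left, ∃ O : (A.translationActionOver u K).StableAffineOpens, x ∈ O.1)
  [LocallyOfFiniteType (A.X.hom ≫ u)] [IsLocallyNoetherian Y]
  (hG : ∃ _ : GrpObj (A.quotientOver u K), IsMonHom (A.quotientMk u K hcov))
  (hsm : Smooth (A.quotientOver u K).hom) (hgc : GeometricallyConnected (A.quotientOver u K).hom)
  (D : A.DualPair) [IsAffine Y]
  (hfree : ∀ (Ω : Type u) [Field Ω] [IsAlgClosed Ω] (x : Spec (.of Ω) ⟶ A.left) (σ : K), σ ≠ 1 →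
    x ≫ (A.translation (σ : A.Sections)).left ≠ x)

variable
  -- the dual side: a finite subgroup `K′ ≤ Â(S)` with the file-(i) hypotheses for `(Â, K′)`
  (K' : Subgroup D.hat.Sections) [Finite K'] [IsSeparated (D.hat.X.hom ≫ u)]
  (hcov' : ∀ x : D.hat.left, ∃ O : (D.hat.translationActionOver u K').StableAffineOpens, x ∈ O.1)
  [LocallyOfFiniteType (D.hat.X.hom ≫ u)]
  (hG' : ∃ _ : GrpObj (D.hat.quotientOver u K'), IsMonHom (D.hat.quotientMk u K' hcov'))
  (hsm' : Smooth (D.hat.quotientOver u K').hom) (hgc' : GeometricallyConnected (D.hat.quotientOver u K').hom)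
  (hfree' : ∀ (Ω : Type u) [Field Ω] [IsAlgClosed Ω] (x : Spec (.of Ω) ⟶ D.hat.left) (σ : K'), σ ≠ 1 →
    x ≫ (D.hat.translation (σ : D.hat.Sections)).left ≠ x)
  -- D3b's output: a `K′`-equivariant structure on `𝒩₁` for the D3a action
  (Φ : (prodTranslationActionOver (A.quotientBy u K hcov hG hsm hgc) D.hat u K' hcov').EquivariantStructure
    (A.poincarePullback u K hK hcov hG hsm hgc D hfree))

/-! ## §1 `𝒫_B` in the `prodLeft` spelling -/

/-- **`𝒫_B` READ ON `(A/K) ×_S (Â/K′)` in the `prodLeft` spelling of ★ `DualPair.P`** (the carrier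
`((A/K).X ⊗ (Â/K′).X).left` of ★ `poincareQuot` is `(A/K).prodLeft (Â/K′)` by `rfl`; the same module).
[cite: MumfordAV1970, §15 Thm. 1 (p. 143)] -/
abbrev poincareQuotProd :
    ((A.quotientBy u K hcov hG hsm hgc).prodLeft (D.hat.quotientBy u K' hcov' hG' hsm' hgc')).Modules :=
  A.poincareQuot u K hK hcov hG hsm hgc D hfree K' hcov' Φ

include hfree' in
/-- `𝒫_B` is a line bundle (★ `hasRank_poincareQuot`). [cite: MumfordAV1970, §12 Thm. 1 (p. 112)] -/
theorem hasRank_poincareQuotProd : HasRank (A.poincareQuotProd u K hK hcov hG hsm hgc D hfree K' hcov' hG' hsm' hgc' Φ) 1 :=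
  A.hasRank_poincareQuot u K hK hcov hG hsm hgc D hfree K' hcov' hfree' Φ

include hfree' in
/-- `(B ◁ ψ̂)^* 𝒫_B ≅ 𝒩₁` (★ `poincareQuotIso`), with `ψ̂` read as an `S`-morphism `Â → Â/K′` of abelian schemes and `𝒩₁` as
the module of the rigidified family ★ `poincarePullbackBundle`. [cite: MumfordAV1970, §15 Thm. 1 (p. 143)] -/
theorem nonempty_pullback_whiskerLeft_poincareQuotProd_iso :
    Nonempty ((Scheme.Modules.pullback ((A.quotientBy u K hcov hG hsm hgc).X ◁
        (show D.hat.X ⟶ (D.hat.quotientBy u K' hcov' hG' hsm' hgc').X from D.hat.quotientMk u K' hcov')).left).obj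
        (A.poincareQuotProd u K hK hcov hG hsm hgc D hfree K' hcov' hG' hsm' hgc' Φ) ≅
      (A.poincarePullbackBundle u K hK hcov hG hsm hgc D hfree).L) :=
  ⟨A.poincareQuotIso u K hK hcov hG hsm hgc D hfree K' hcov' hfree' Φ⟩

/-! ## §2 The rigidified descended Poincaré sheaf and its three clauses -/

/-- **`𝒫_B^{rig} := rigidify 𝒫_B = 𝒫_B ⊗ (pr^* (e_B × 1)^* 𝒫_B)^∨`** — the descended Poincaré sheaf normalised along
`e_B × 1_{Â/K′}` ([MumfordFogartyKirwan1994] Ch. 6 §2 p. 121). [cite: MumfordFogartyKirwan1994, Ch. 6 §2 (p. 121)] -/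
def poincareQuotRigid :
    ((A.quotientBy u K hcov hG hsm hgc).prodLeft (D.hat.quotientBy u K' hcov' hG' hsm' hgc')).Modules :=
  (A.quotientBy u K hcov hG hsm hgc).rigidify (D.hat.quotientBy u K' hcov' hG' hsm' hgc')
    (A.poincareQuotProd u K hK hcov hG hsm hgc D hfree K' hcov' hG' hsm' hgc' Φ)

include hfree' in
/-- `𝒫_B^{rig}` is a line bundle (★ `hasRank_rigidify`). [cite: MumfordAV1970, §12 Thm. 1 (p. 112)] -/
theorem hasRank_poincareQuotRigid : HasRank (A.poincareQuotRigid u K hK hcov hG hsm hgc D hfree K' hcov' hG' hsm' hgc' Φ) 1 :=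
  hasRank_rigidify (A.hasRank_poincareQuotProd u K hK hcov hG hsm hgc D hfree K' hcov' hG' hsm' hgc' hfree' Φ)

include hfree' in
/-- **`(B ◁ ψ̂)^* 𝒫_B^{rig} ≅ 𝒩₁`** — the defining isomorphism survives the rigidification, because `𝒩₁` is itself rigidified
along `e_B × 1_Â` (★ `nonempty_pullback_whiskerLeft_rigidify_iso`). [cite: MumfordAV1970, §15 Thm. 1 (p. 143)]
[cite: MumfordFogartyKirwan1994, Ch. 6 §2 (p. 121)] -/
theorem nonempty_pullback_whiskerLeft_poincareQuotRigid_iso :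
    Nonempty ((Scheme.Modules.pullback ((A.quotientBy u K hcov hG hsm hgc).X ◁
        (show D.hat.X ⟶ (D.hat.quotientBy u K' hcov' hG' hsm' hgc').X from D.hat.quotientMk u K' hcov')).left).obj
        (A.poincareQuotRigid u K hK hcov hG hsm hgc D hfree K' hcov' hG' hsm' hgc' Φ) ≅
      (A.poincarePullbackBundle u K hK hcov hG hsm hgc D hfree).L) :=
  nonempty_pullback_whiskerLeft_rigidify_iso
    (A.hasRank_poincareQuotProd u K hK hcov hG hsm hgc D hfree K' hcov' hG' hsm' hgc' hfree' Φ)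
    (show D.hat.X ⟶ (D.hat.quotientBy u K' hcov' hG' hsm' hgc').X from D.hat.quotientMk u K' hcov')
    (A.poincarePullbackBundle u K hK hcov hG hsm hgc D hfree)
    (A.nonempty_pullback_whiskerLeft_poincareQuotProd_iso u K hK hcov hG hsm hgc D hfree K' hcov' hG' hsm' hgc' hfree' Φ)

include hfree' in
/-- **Clause (b) `rigid` for `𝒫_B^{rig}`**: `(e_B × 1_{Â/K′})^* 𝒫_B^{rig} ≅ 𝒪` (★ `nonempty_pullback_unitSlice_rigidify_iso`) — the
text of the field `rigid` of ★ `DualPair` at `(A/K, Â/K′, 𝒫_B^{rig})`. [cite: MumfordFogartyKirwan1994, Ch. 6 §2 (p. 121)]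
[cite: MilneAV2008, I §8 (pp. 36–37)] -/
theorem rigid_poincareQuotRigid :
    Nonempty ((Scheme.Modules.pullback ((A.quotientBy u K hcov hG hsm hgc).unitSlice
      (D.hat.quotientBy u K' hcov' hG' hsm' hgc'))).obj
        (A.poincareQuotRigid u K hK hcov hG hsm hgc D hfree K' hcov' hG' hsm' hgc' Φ) ≅ SheafOfModules.unit _) :=
  nonempty_pullback_unitSlice_rigidify_iso
    (A.hasRank_poincareQuotProd u K hK hcov hG hsm hgc D hfree K' hcov' hG' hsm' hgc' hfree' Φ)

include hfree' in
/-- **Clause (a) `fibrewisePicZero` for `𝒫_B^{rig}`** (★ `forall_isHomogeneous_fibreSlice_of_descended` applied to `𝒫_B^{rig}`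
and its isomorphism with `𝒩₁` after `(B ◁ ψ̂)^*`) — the text of the field `fibrewisePicZero` of ★ `DualPair` at
`(A/K, Â/K′, 𝒫_B^{rig})`. [cite: MumfordAV1970, §8 ((iv) ⇔ (i)); §15 Thm. 1 (p. 143)] [cite: MilneAV2008, I §8 (pp. 36–37)] -/
theorem fibrewisePicZero_poincareQuotRigid (Ω : Type u) [Field Ω] [IsAlgClosed Ω]
    (b : Spec (.of Ω) ⟶ (D.hat.quotientBy u K' hcov' hG' hsm' hgc').X.left) :
    IsHomogeneous ((A.quotientBy u K hcov hG hsm hgc).fibre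
        (b ≫ (D.hat.quotientBy u K' hcov' hG' hsm' hgc').X.hom)).toAbelianVariety
      ((Scheme.Modules.pullback ((A.quotientBy u K hcov hG hsm hgc).fibreSlice
        (D.hat.quotientBy u K' hcov' hG' hsm' hgc') b)).obj
        (A.poincareQuotRigid u K hK hcov hG hsm hgc D hfree K' hcov' hG' hsm' hgc' Φ)) :=
  A.forall_isHomogeneous_fibreSlice_of_descended u K hK hcov hG hsm hgc D hfree K' hcov' hG' hsm' hgc'
    (A.poincareQuotRigid u K hK hcov hG hsm hgc D hfree K' hcov' hG' hsm' hgc' Φ)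
    (A.nonempty_pullback_whiskerLeft_poincareQuotRigid_iso u K hK hcov hG hsm hgc D hfree K' hcov' hG' hsm' hgc' hfree' Φ)
    Ω b

/-! ## §3 The assembly -/

/-- **THE DUAL PAIR OF `A/K` WITH THE RIGIDIFIED DESCENDED POINCARÉ SHEAF** (assembly): `hat := Â/K′`, `P := 𝒫_B^{rig}`;
`hasRank_one`, `rigid`, `fibrewisePicZero` PROVED; the universal property `h4` over all `T → S` (D6) is the one raw
hypothesis. [cite: MumfordAV1970, §15 Thm. 1 (p. 143)] [cite: MilneAV2008, I §9 Thm. 9.1 (p. 42)] -/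
def dualPairOfQuotientRigidified
    (h4 : ∀ {T : Scheme.{u}} (f : T ⟶ S) (ℒ : (A.quotientBy u K hcov hG hsm hgc).RigidifiedLineBundle f),
      ℒ.FibrewisePicZero →
      ∃! g : {g : T ⟶ (D.hat.quotientBy u K' hcov' hG' hsm' hgc').X.left //
          g ≫ (D.hat.quotientBy u K' hcov' hG' hsm' hgc').X.hom = f},
        Nonempty ((Scheme.Modules.pullback ((A.quotientBy u K hcov hG hsm hgc).baseChangeToProd
          (D.hat.quotientBy u K' hcov' hG' hsm' hgc') f g.1 g.2)).obj
            (A.poincareQuotRigid u K hK hcov hG hsm hgc D hfree K' hcov' hG' hsm' hgc' Φ) ≅ ℒ.L)) :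
    (A.quotientBy u K hcov hG hsm hgc).DualPair where
  hat := D.hat.quotientBy u K' hcov' hG' hsm' hgc'
  P := A.poincareQuotRigid u K hK hcov hG hsm hgc D hfree K' hcov' hG' hsm' hgc' Φ
  hasRank_one := A.hasRank_poincareQuotRigid u K hK hcov hG hsm hgc D hfree K' hcov' hG' hsm' hgc' hfree' Φ
  rigid := A.rigid_poincareQuotRigid u K hK hcov hG hsm hgc D hfree K' hcov' hG' hsm' hgc' hfree' Φ
  fibrewisePicZero := A.fibrewisePicZero_poincareQuotRigid u K hK hcov hG hsm hgc D hfree K' hcov' hG' hsm' hgc' hfree' Φ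
  universal := h4

/-- The dual abelian scheme of the assembly is `Â/K′`. [cite: MumfordAV1970, §15 Thm. 1 (p. 143)] -/
theorem dualPairOfQuotientRigidified_hat (h4) :
    (A.dualPairOfQuotientRigidified u K hK hcov hG hsm hgc D hfree K' hcov' hG' hsm' hgc' hfree' Φ h4).hat =
      D.hat.quotientBy u K' hcov' hG' hsm' hgc' := rfl

/-- The Poincaré sheaf of the assembly is `𝒫_B^{rig}`. [cite: MumfordAV1970, §15 Thm. 1 (p. 143)] -/
theorem dualPairOfQuotientRigidified_P (h4) :
    (A.dualPairOfQuotientRigidified u K hK hcov hG hsm hgc D hfree K' hcov' hG' hsm' hgc' hfree' Φ h4).P =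
      A.poincareQuotRigid u K hK hcov hG hsm hgc D hfree K' hcov' hG' hsm' hgc' Φ := rfl

end AbelianSchemeOver

end Literature.AlgebraicGeometry.AbelianSchemes

end
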